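import Summits.AnomalousDissipation.AnomalousDissipation.Theses.TwoAndHalfD
import Summits.AnomalousDissipation.AnomalousDissipation.Theorems.TwoAndHalfDTwohalfdThesisClassicalTransfer
import Summits.AnomalousDissipation.AnomalousDissipation.Theorems.TwoAndHalfDScalarAnomalySteadySourceFormalProfileMixerTransfer

/-!
# Crux `TwoAndHalfD.TwohalfdThesis` (stmt-AnomalousDissipation-0206): the PROFILE-MIXER junction
# `profile-mixer spec of the sibling crux (stmt-0448, S1') ⇒ TwohalfdThesis`

Support file (everything proved; `--supports stmt-AnomalousDissipation-0206`, registered sub-goal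
`twohalfdThesis_of_profileMixerRealizable` of the line `Sketch` = duhamel-release).  The two open cruxes of the route
`TwoAndHalfD` — the target `TwohalfdThesis` (X, this item) and `ScalarAnomalySteadySourceFormal` (#2, stmt-0448) — are
each driven by a line whose checked skeleton is closed modulo ONE residual existential stub about the same object: a
steadily forced classical planar Navier–Stokes family with pointwise bounded energy that mixes ONE smooth profile `h`
uniformly in the viscosity.  The sibling line `budgeted-mixer-template` types that residual as the PROFILE-MIXER SPEC
(its registered stub `stub_profileMixerRealizable`, S1'): an antitone release majorant `ρm ≥ 0` with `∫₀ᵗ ρm ≤ R`, a lag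
`L > 0` and a cold-start floor `c₀ > 0` coupled to the tail by `‖h‖²∫_L^t ρm ≤ c₀/2`, with (Decay) every classical release of
`h` from any start time `s ≥ 0` dominated by `ρm(· - s)‖h‖` in `L²` and (Floor) every classical cold start of the `h`-sourced
problem on `[s, s + L]` having input power `≥ c₀` at its end.  Its landed transfer file
(`Theorems/TwoAndHalfDScalarAnomalySteadySourceFormalProfileMixerTransfer.lean`) turns the spec into the CLASSICAL package —
global cold starts `θ_j` with `‖θ_j(t)‖² ≤ R²‖h‖²` (`coldStart_variance_le`), input power `≥ c₀/2` after the lag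
(`coldStart_power_ge`) and the dissipation floor `⟨ν_j‖∇θ_j‖²⟩ ≥ c₀/2` (`DissipationFromPower.stub_dissipationFromPower`) —
before downgrading to the weak notions of #2.  This file observes that the classical package is exactly the hypothesis of the
landed classical junction of THIS crux (`twohalfdThesis_of_classicalScalarAnomaly`,
`Theorems/TwoAndHalfDTwohalfdThesisClassicalTransfer.lean`), so the profile-mixer spec implies the TARGET `X` directly and
sorry-free — without the route's open weak glue item `ScalarLiftGlueR` (stmt-14984) and without this line's own residual W
(`stub_releasedMixingWitness`).  Consequence for the planners: ONE open kernel (S1' of stmt-0448) now closes BOTH cruxes of the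
route by name; W of this line is a second, weaker-floored entrance (liminf-mean Green–Kubo floor instead of a finite-lag
pathwise floor, spin-up time `s₀`, no monotonicity of the envelope).  References: Bruè–De Lellis 2023 §3 (2½-D lifts);
Doering–Foias 2002 §2 (budgets); the Green–Kubo tail argument is the sibling file's.
-/

noncomputable section

-- D-0017: single-problem summit ⇒ `Summit.AnomalousDissipation.AnomalousDissipation.…`.
set_option linter.dupNamespace false

namespace Summit.AnomalousDissipation.AnomalousDissipation.Theorems.TwohalfdThesis

open MeasureTheory Set Filter Topology
open scoped ENNReal NNReal InnerProductSpace
open Literature.Analysis.FunctionSpaces Literature.Analysis.FluidPDE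
open Summit.AnomalousDissipation.AnomalousDissipation.Theses.TwoAndHalfD
open Summit.AnomalousDissipation.AnomalousDissipation.Theorems.ScalarAnomalySteadySourceFormal

/-- **Profile-mixer spec ⇒ `TwohalfdThesis`** (junction of the two crux lines of route `TwoAndHalfD`).  Hypothesis:
verbatim the body of the sibling crux's registered residual stub `stub_profileMixerRealizable` (stmt-0448, line
`budgeted-mixer-template`, S1'): a smooth solenoidal mean-zero steady planar force `g`, a smooth mean-zero profile `h`,
viscosities `ν_j → 0`, classical Navier–Stokes solutions `(v_j, p_j)` on `[0, ∞) × T²` forced by `g` with `∫‖v_j(t)‖² ≤ E`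
(`t ≥ 0`), an antitone majorant `ρm ≥ 0` with `∫₀ᵗ ρm ≤ R`, a lag `L > 0` and a floor `c₀ > 0` with `‖h‖²∫_L^t ρm ≤ c₀/2`
(`t ≥ L`), such that (Decay) every classical release of `h` into `v_j` from any `s ≥ 0` obeys
`‖φ(t)‖² ≤ ρm(t - s)²‖h‖²` and (Floor) every classical cold start of the `h`-sourced unit-Prandtl problem on `[s, s + L]` has
`∫ h θ'(s + L) ≥ c₀`.  Conclusion: `TwohalfdThesis`.  Proof: the sibling transfer's classical half — global cold starts
(`ColdStartVariance.exists_global_coldStart`), variance `≤ R²‖h‖²` (`ProfileMixerTransfer.coldStart_variance_le`), power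
`≥ c₀/2` for `t ≥ L` (`ProfileMixerTransfer.coldStart_power_ge`), dissipation floor `c₀/2`
(`DissipationFromPower.stub_dissipationFromPower`) — feeds the classical junction `twohalfdThesis_of_classicalScalarAnomaly`
(2½-D lift, Leray–Hopf from its own slice, lifted budgets). [folklore] -/
theorem twohalfdThesis_of_profileMixerRealizable :
    (∃ (g : UnitAddTorus (Fin 2) → EuclideanSpace ℝ (Fin 2)) (h : UnitAddTorus (Fin 2) → ℝ),
      Torus.IsSmooth g ∧ Torus.IsDivFree g ∧ Torus.HasZeroMean g ∧
      Torus.IsSmooth h ∧ Torus.HasZeroMean h ∧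
      ∃ (ν : ℕ → ℝ) (v : ℕ → ℝ → UnitAddTorus (Fin 2) → EuclideanSpace ℝ (Fin 2))
        (p : ℕ → ℝ → UnitAddTorus (Fin 2) → ℝ) (ρm : ℝ → ℝ) (E R L c₀ : ℝ),
        (∀ j, 0 < ν j) ∧ Tendsto ν atTop (𝓝 0) ∧ 0 < L ∧ 0 < c₀ ∧
        Antitone ρm ∧ (∀ r, 0 ≤ ρm r) ∧ (∀ t, 0 ≤ t → ∫ r in (0 : ℝ)..t, ρm r ≤ R) ∧
        (∀ t, L ≤ t → Torus.scalarL2Sq h * ∫ r in L..t, ρm r ≤ c₀ / 2) ∧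
        (∀ j, Torus.IsClassicalNSSolutionOn (Set.Ici 0) (ν j) (fun _ => g) (v j) (p j)) ∧
        (∀ j t, 0 ≤ t → ∫ x, ‖v j t x‖ ^ 2 ≤ E) ∧
        (∀ j (s T' : ℝ), 0 ≤ s → ∀ φ : ℝ → UnitAddTorus (Fin 2) → ℝ,
            Torus.IsClassicalScalarTransportOn (Set.Icc s T') (ν j) (v j) φ → φ s = h →
            ∀ t ∈ Set.Icc s T', Torus.scalarL2Sq (φ t) ≤ ρm (t - s) ^ 2 * Torus.scalarL2Sq h) ∧
        (∀ j (s : ℝ), 0 ≤ s → ∀ θ' : ℝ → UnitAddTorus (Fin 2) → ℝ,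
            Torus.IsClassicalScalarTransportForcedOn (Set.Icc s (s + L)) (ν j) (v j) (fun _ => h) θ' →
            θ' s = (fun _ => (0 : ℝ)) → c₀ ≤ ∫ x, h x * θ' (s + L) x)) →
    TwohalfdThesis := by
  rintro ⟨g, h, hgs, hgd, hgm, hhs, hhm, ν, v, p, ρm, E, R, L, c₀, hν, hν0, hL, hc₀, hanti, hnn, hR,
    hsmall, hNS, hE, hDecay, hFloor⟩
  -- one global cold-start scalar per `j`
  have hex : ∀ j, ∃ θ : ℝ → UnitAddTorus (Fin 2) → ℝ,
      Torus.IsClassicalScalarTransportForcedOn (Set.Ici 0) (ν j) (v j) (fun _ => h) θ ∧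
      θ 0 = fun _ => (0 : ℝ) := fun j =>
    ColdStartVariance.exists_global_coldStart (hν j) (hNS j).smooth_velocity (hNS j).divFree hhs
  choose θ hθ hθ0 using hex
  -- variance of the cold starts
  have hVar : ∀ j t, 0 ≤ t → Torus.scalarL2Sq (θ j t) ≤ R ^ 2 * Torus.scalarL2Sq h := fun j t ht =>
    ProfileMixerTransfer.coldStart_variance_le (hν j) (hNS j).smooth_velocity (hNS j).divFree hhs hanti hnn
      (hDecay j) hR (hθ j) (hθ0 j) ht
  -- eventual input-power floor
  have hpow : ∀ j t, L ≤ t → c₀ / 2 ≤ ∫ x, h x * θ j t x := fun j t ht =>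
    ProfileMixerTransfer.coldStart_power_ge (hν j) (hNS j).smooth_velocity (hNS j).divFree hhs hanti hnn
      (hDecay j) hL hsmall hc₀ (hFloor j) (hθ j) (hθ0 j) ht
  -- dissipation floor
  have hflux : ∀ j, c₀ / 2 ≤
      longTimeAvgSup (fun t => ν j * (Torus.eScalarGradNormSq (θ j t)).toReal) := fun j =>
    DissipationFromPower.stub_dissipationFromPower (ν j) (R ^ 2 * Torus.scalarL2Sq h) (c₀ / 2) L (v j) h
      (θ j) (hν j).le (hθ j) (hVar j) (hpow j)
  -- the classical junction of this crux
  exact twohalfdThesis_of_classicalScalarAnomaly ⟨g, h, hgs, hgd, hgm, hhs, hhm, ν, v, p, θ, E,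
    R ^ 2 * Torus.scalarL2Sq h, c₀ / 2, hν, hν0, hNS, hθ, hE, hVar, half_pos hc₀, hflux⟩

end Summit.AnomalousDissipation.AnomalousDissipation.Theorems.TwohalfdThesis

end
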